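import Literature.Computability.Cryptography.InaccessibleEntropyUOWHFProgram
import Literature.Computability.Cryptography.OneWayFunctionsLengthPreserving
import Literature.Computability.Cryptography.UOWHFRestricted
import Literature.Computability.Complexity.SplitOnesBricks
import HarnessLib

/-!
# One-way functions ⇒ UOWHF, machine layer III: the hash family (chaining, concatenation) and its efficiency

Topic `Literature/Computability/Cryptography`; eleventh file of the "one-way functions ⇒ universal one-way
hash functions" line (Haitner–Holenstein–Reingold–Vadhan–Wee 2020, proof of Thm. 5.1; sizes in
`InaccessibleEntropyUOWHFParams.lean`, candidates `candStr`/`candP` in `InaccessibleEntropyUOWHFProgram.lean`).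
Step 5 of the proof of Thm. 5.1 extends the input length of each of the `J + 1` candidates
`G^{(j)} : {0,1}^N → {0,1}^{N−1}` by chaining `R = J(N−1)` one-bit extensions with independent keys
(Lemma 5.7: `st₀ = x ↾ N`, `st_{r+1} = G_{y_r}(st_r) ++ x_{N+r}`, value `G_{y_R}(st_R)`) and concatenates the
`J + 1` chains on the same input, giving `{0,1}^d → {0,1}^{d−1}`, `d = N + R`. This file writes that
evaluator as a total string function and as an `FP` brick, and packages the **hash collection**
`HHRVW.family p f` of the tree's `HashCollection` type (`UOWHF.lean`):

* `keyAt kb n j r`, `chainSt f n j kb x r`, `chainOutStr`, `evalStr f n kb x` — the string semantics;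
  `length_evalStr` (`= (J+1)(N−1) = d − 1` on `|x| = d`);
* bricks `chainP f` (a clipped counted loop of `candP`, `chainP_apply`, `chainP_mem_FP`) and `evalP f`
  (`evalP_apply`, `evalP_mem_FP`);
* `family p f : HashCollection` — index sampler `I(1ⁿ; r) = 1ⁿ 0 r` on `p(n)` coins (so `|s| = p(n) + n + 1`
  and `n` is recovered by the clocked search `LenPres.nOfFn p` of `OneWayFunctionsLengthPreserving.lean`),
  evaluation `h_s(x) = fitLen ((J+1)(N−1)) (evalStr f n kb x)` with `n = nOf p |s|`, `kb` the bits after the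
  first `0` of `s` (the length normalisation makes the range condition hold for every index string);
  `family_hash_eq` (the value on well-formed indices), `isEfficient_family` (for `f ∈ FP`),
  `length_family_hash`, `length_index_family`.

The polynomial `p` is a parameter (any `p ≥ K` serves; the key uses the first `K(n)` coin bits). All
statements proved; no named facts.

## References

* I. Haitner, T. Holenstein, O. Reingold, S. Vadhan, H. Wee, *Inaccessible Entropy II: IE Functions and
  Universal One-Way Hashing*, Theory of Computing 16(8) (2020), proof of Thm. 5.1, Step 5, and Lemma 5.7.
* O. Goldreich, *Foundations of Cryptography II*, CUP 2004, §6.4.3.2, Construction 6.4.22 (composition with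
  independent keys), Def. 6.4.19.
-/

namespace Literature.Computability.Cryptography

namespace HHRVW

open _root_.Computability Complexity Complexity.Brick Complexity.Plumb Complexity.UExpr AffineStr Sz Filter

/-! ### String semantics of chaining and concatenation -/

section Semantics

variable (f : List Bool → List Bool) (n : ℕ)

/-- The key of chain `j`, level `r`: bits `[(j(R+1) + r)·N, … + N)` of the key string. [cite: HaitnerEtAl2020, proof of Thm. 5.1, Step 5] -/
def keyAt (kb : List Bool) (j r : ℕ) : List Bool := (kb.drop ((j * (R n + 1) + r) * N n)).take (N n)

/-- The chain state of component `j` after `r` levels: `st₀ = x ↾ N`, `st_{r+1} = G_{y_r}(st_r) ++ x_{N+r}`.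
[cite: HaitnerEtAl2020, Lemma 5.7] -/
def chainSt (j : ℕ) (kb x : List Bool) : ℕ → List Bool
  | 0 => x.take (N n)
  | r + 1 => candStr f n j (keyAt n kb j r) (chainSt j kb x r) ++ (x.drop (N n + r)).take 1

/-- The value of chain `j`: `G_{y_R}(st_R)`. [cite: HaitnerEtAl2020, Lemma 5.7] -/
def chainOutStr (j : ℕ) (kb x : List Bool) : List Bool := candStr f n j (keyAt n kb j (R n)) (chainSt f n j kb x (R n))

/-- **The evaluator**: the concatenation of the `J + 1` chains on the same input. [cite: HaitnerEtAl2020, proof of Thm. 5.1, Step 5] -/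
def evalStr (kb x : List Bool) : List Bool := ccat (fun j => chainOutStr f n j kb x) (Jp1 n)

variable {f n}

/-- `|keyAt| ≤ N`. [folklore] -/
theorem length_keyAt_le (kb : List Bool) (j r : ℕ) : (keyAt n kb j r).length ≤ N n := by
  rw [keyAt, List.length_take]; exact min_le_left _ _

/-- `|keyAt| = N` when the key string is long enough (`j < J+1`, `r ≤ R`, `|kb| ≥ K`). [folklore] -/
theorem length_keyAt {kb : List Bool} {j r : ℕ} (hkb : K n ≤ kb.length) (hj : j < Jp1 n) (hr : r ≤ R n) :
    (keyAt n kb j r).length = N n := by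
  rw [keyAt, List.length_take, List.length_drop, min_eq_left]
  have h1 : (j * (R n + 1) + r) + 1 ≤ Jp1 n * (R n + 1) := by
    calc (j * (R n + 1) + r) + 1 ≤ j * (R n + 1) + (R n + 1) := by omega
      _ = (j + 1) * (R n + 1) := by ring
      _ ≤ Jp1 n * (R n + 1) := Nat.mul_le_mul_right _ hj
  have h2 : (j * (R n + 1) + r) * N n + N n ≤ K n := by
    rw [K, ← Nat.succ_mul]; exact Nat.mul_le_mul_right _ h1
  omega

/-- `|chainSt r| ≤ N` for every `r`. [folklore] -/
theorem length_chainSt_le (j : ℕ) (kb x : List Bool) : ∀ r, (chainSt f n j kb x r).length ≤ N n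
  | 0 => by rw [chainSt, List.length_take]; exact min_le_left _ _
  | r + 1 => by
    rw [chainSt, List.length_append, List.length_take]
    have := length_F3Str_le (f := f) (n := n) j (List.zipWith xor (keyAt n kb j r) (chainSt f n j kb x r))
    have := Nm1_add_one n
    rw [candStr]; omega

/-- `|chainSt r| = N` for `r ≤ R` on well-formed data (`|x| = d`, `|kb| ≥ K`, `j ≤ J`). [folklore] -/
theorem length_chainSt {j : ℕ} {kb x : List Bool} (hkb : K n ≤ kb.length) (hj : j < Jp1 n) (hx : x.length = d n) :
    ∀ {r}, r ≤ R n → (chainSt f n j kb x r).length = N n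
  | 0, _ => by rw [chainSt, List.length_take, hx, min_eq_left (N_le_d n)]
  | r + 1, hr => by
    rw [chainSt, List.length_append, length_candStr (length_keyAt hkb hj (by omega)) (length_chainSt hkb hj hx (by omega)),
      List.length_take, List.length_drop, hx, d_eq, min_eq_left (by omega), Nm1_add_one]

/-- `|chainOutStr| = N − 1` on well-formed data. [folklore] -/
theorem length_chainOutStr {j : ℕ} {kb x : List Bool} (hkb : K n ≤ kb.length) (hj : j < Jp1 n) (hx : x.length = d n) :
    (chainOutStr f n j kb x).length = Nm1 n :=
  length_candStr (length_keyAt hkb hj le_rfl) (length_chainSt hkb hj hx le_rfl)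

/-- `|chainOutStr| ≤ N − 1` always. [folklore] -/
theorem length_chainOutStr_le (j : ℕ) (kb x : List Bool) : (chainOutStr f n j kb x).length ≤ Nm1 n :=
  length_F3Str_le _ _

/-- **`|evalStr| = (J+1)(N−1) = d − 1`** on well-formed data. [cite: HaitnerEtAl2020, proof of Thm. 5.1, Step 5] -/
theorem length_evalStr {kb x : List Bool} (hkb : K n ≤ kb.length) (hx : x.length = d n) :
    (evalStr f n kb x).length = Jp1 n * Nm1 n :=
  BitCodec.length_ccat_blocks fun _ hj => length_chainOutStr hkb hj hx

/-- `|evalStr| ≤ (J+1)(N−1)` always. [folklore] -/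
theorem length_evalStr_le (kb x : List Bool) : (evalStr f n kb x).length ≤ Jp1 n * Nm1 n :=
  length_ccat_le' _ fun j _ => length_chainOutStr_le j kb x

end Semantics

/-! ### The chain as a brick -/

section ChainBrick

/-! Records. The context is `ctx = ⟨1ⁿ, ⟨kb, x⟩⟩`; the chain of component `j` works on `X = ⟨ctx, 1ʲ⟩`; the
counted loop runs on `z = ⟨X, ⟨counter, ⟨1ʳ, st⟩⟩⟩`. -/

/-- `1ⁿ` from `X`. [folklore] -/
noncomputable def XnF : List Bool → List Bool := nthF 0 ∘ fstF
/-- `kb` from `X`. [folklore] -/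
noncomputable def XkF : List Bool → List Bool := nthF 1 ∘ fstF
/-- `x` from `X`. [folklore] -/
noncomputable def XxF : List Bool → List Bool := sndPow 1 ∘ fstF
/-- `1ʲ` from `X`. [folklore] -/
noncomputable def XjF : List Bool → List Bool := sndF
/-- The size record `⟨1ⁿ, ⟨1ʲ, ε⟩⟩` from `X`. [folklore] -/
noncomputable def XszF (e : UExpr) : List Bool → List Bool := szF e ∘ fanoutFn XnF (fanoutFn XjF fun _ => [])

variable (n j : ℕ) (kb x : List Bool)

/-- The record `X`. [folklore] -/
def Xrec : List Bool := boolPair (boolPair (ones n) (boolPair kb x)) (ones j)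

/-- Bookkeeping lemma (record accessors, codec lengths). [folklore] -/
@[simp] theorem XnF_X : XnF (Xrec n j kb x) = ones n := by simp [XnF, Xrec]
/-- Bookkeeping lemma (record accessors, codec lengths). [folklore] -/
@[simp] theorem XkF_X : XkF (Xrec n j kb x) = kb := by simp [XkF, Xrec]
/-- Bookkeeping lemma (record accessors, codec lengths). [folklore] -/
@[simp] theorem XxF_X : XxF (Xrec n j kb x) = x := by simp [XxF, Xrec]
/-- Bookkeeping lemma (record accessors, codec lengths). [folklore] -/
@[simp] theorem XjF_X : XjF (Xrec n j kb x) = ones j := by simp [XjF, Xrec]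
/-- Bookkeeping lemma (record accessors, codec lengths). [folklore] -/
@[simp] theorem XszF_X (e : UExpr) : XszF e (Xrec n j kb x) = ones (e.eval fun i => if i = 0 then n else j) := by
  rw [XszF, Function.comp_apply, fanoutFn_apply, fanoutFn_apply, XnF_X, XjF_X, szF_boolPair₂]

/-- Bookkeeping lemma (record accessors, codec lengths). [folklore] -/
theorem XnF_mem_FP : XnF ∈ FP := comp_mem_FP (nthF_mem_FP 0) fstF_mem_FP
/-- Bookkeeping lemma (record accessors, codec lengths). [folklore] -/
theorem XkF_mem_FP : XkF ∈ FP := comp_mem_FP (nthF_mem_FP 1) fstF_mem_FP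
/-- Bookkeeping lemma (record accessors, codec lengths). [folklore] -/
theorem XxF_mem_FP : XxF ∈ FP := comp_mem_FP (sndPow_mem_FP 1) fstF_mem_FP
/-- Bookkeeping lemma (record accessors, codec lengths). [folklore] -/
theorem XjF_mem_FP : XjF ∈ FP := sndF_mem_FP
/-- Bookkeeping lemma (record accessors, codec lengths). [folklore] -/
theorem XszF_mem_FP (e : UExpr) : XszF e ∈ FP :=
  comp_mem_FP (szF_mem_FP e) (fanoutFn_mem_FP XnF_mem_FP (fanoutFn_mem_FP XjF_mem_FP (const_mem_FP _)))

/-- On the loop record `z = ⟨X, ⟨cnt, ⟨1ʳ, st⟩⟩⟩`: the key of level `r`,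
`(kb ⇂ (j(R+1) + r)·N) ↾ N`. [cite: HaitnerEtAl2020, Lemma 5.7] -/
noncomputable def keyF : List Bool → List Bool :=
  takeFn ∘ fanoutFn (XszF E.N ∘ nthF 0) (dropFn ∘ fanoutFn
    (HashBricks.umulFn ∘ fanoutFn (catF (HashBricks.umulFn ∘ fanoutFn (XjF ∘ nthF 0) (XszF (add E.R (cst 1)) ∘ nthF 0)) (nthF 2))
      (XszF E.N ∘ nthF 0)) (XkF ∘ nthF 0))

/-- On the loop record: the extension bit `x_{N+r}` (as a string of length `≤ 1`). [cite: HaitnerEtAl2020, Lemma 5.7] -/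
noncomputable def cbitF : List Bool → List Bool :=
  takeFn ∘ fanoutFn (fun _ => [true]) (dropFn ∘ fanoutFn (catF (XszF E.N ∘ nthF 0) (nthF 2)) (XxF ∘ nthF 0))

/-- On the loop record: `G_{y_r}(st)` by the candidate brick on `⟨1ⁿ, ⟨1ʲ, ⟨key_r, st⟩⟩⟩`. [cite: HaitnerEtAl2020, Lemma 5.7] -/
noncomputable def stepF (f : List Bool → List Bool) : List Bool → List Bool :=
  candP f ∘ fanoutFn (XnF ∘ nthF 0) (fanoutFn (XjF ∘ nthF 0) (fanoutFn keyF (sndPow 2)))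

/-- The loop body: `⟨1ʳ, st⟩ ↦ ⟨1ʳ⁺¹, G_{y_r}(st) ++ x_{N+r}⟩`, clipped to `|X| + 1` symbols. [cite: HaitnerEtAl2020, Lemma 5.7] -/
noncomputable def bodyF (f : List Bool → List Bool) : List Bool → List Bool :=
  clipF 1 (fanoutFn (List.cons true ∘ nthF 2) (catF (stepF f) cbitF))

/-- The loop record `⟨X, ⟨cnt, ⟨1ʳ, st⟩⟩⟩`. [folklore] -/
def Zrec (cnt : List Bool) (r : ℕ) (st : List Bool) : List Bool := boolPair (Xrec n j kb x) (boolPair cnt (boolPair (ones r) st))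

variable {n j kb x}

/-- Value of `keyF`. [folklore] -/
theorem keyF_Z (cnt : List Bool) (r : ℕ) (st : List Bool) : keyF (Zrec n j kb x cnt r st) = keyAt n kb j r := by
  rw [keyF, Zrec]
  simp only [Function.comp_apply, fanoutFn_apply, nthF_zero_boolPair, nthF_succ_boolPair, catF_apply, XszF_X, XjF_X, XkF_X,
    HashBricks.umulFn_boolPair, takeFn_boolPair, dropFn_boolPair, keyAt]
  simp [ones, Nat.add_mul]

/-- Value of `cbitF`. [folklore] -/
theorem cbitF_Z (cnt : List Bool) (r : ℕ) (st : List Bool) : cbitF (Zrec n j kb x cnt r st) = (x.drop (N n + r)).take 1 := by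
  rw [cbitF, Zrec]
  simp only [Function.comp_apply, fanoutFn_apply, nthF_zero_boolPair, nthF_succ_boolPair, catF_apply, XszF_X, XxF_X,
    takeFn_boolPair, dropFn_boolPair]
  simp [ones]

/-- Value of `stepF`. [folklore] -/
theorem stepF_Z (f : List Bool → List Bool) (cnt : List Bool) (r : ℕ) {st : List Bool} (hst : (keyAt n kb j r).length ≤ st.length) :
    stepF f (Zrec n j kb x cnt r st) = candStr f n j (keyAt n kb j r) st := by
  rw [stepF, Function.comp_apply, fanoutFn_apply, fanoutFn_apply, fanoutFn_apply, keyF_Z]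
  rw [Zrec]
  simp only [Function.comp_apply, nthF_zero_boolPair, XnF_X, XjF_X, sndPow_succ_boolPair, sndPow_zero_boolPair]
  exact candP_apply _ _ _ hst

/-- The unclipped body on the loop record. [folklore] -/
theorem body_raw_Z (f : List Bool → List Bool) (cnt : List Bool) (r : ℕ) {st : List Bool} (hst : (keyAt n kb j r).length ≤ st.length) :
    fanoutFn (List.cons true ∘ nthF 2) (catF (stepF f) cbitF) (Zrec n j kb x cnt r st) =
      boolPair (ones (r + 1)) (candStr f n j (keyAt n kb j r) st ++ (x.drop (N n + r)).take 1) := by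
  rw [fanoutFn_apply, catF_apply, stepF_Z f cnt r hst, cbitF_Z]
  simp [Zrec, ones, List.replicate_succ]

/-- The clip is inactive on the intended records: `2(r+1) + 2 + N ≤ |X| + 1` for `r ≤ R` and `|kb| ≥ K`.
[folklore] -/
theorem body_fits {r : ℕ} (hkb : K n ≤ kb.length) (hr : r ≤ R n) :
    2 * (r + 1) + (Nm1 n + 1) + 2 ≤ 1 * ((Xrec n j kb x).length + 1) := by
  have hK : (R n + 1) * N n ≤ K n :=
    calc (R n + 1) * N n = 1 * ((R n + 1) * N n) := (one_mul _).symm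
      _ ≤ Jp1 n * ((R n + 1) * N n) := Nat.mul_le_mul_right _ (one_le_Jp1 n)
      _ = K n := by rw [K, mul_assoc]
  have hN := Nm1_add_one n
  have h0 : R n ≤ R n * N n := Nat.le_mul_of_pos_right _ (by omega)
  have h1 : R n + N n ≤ (R n + 1) * N n := by rw [Nat.succ_mul]; omega
  simp only [Xrec, length_boolPair, one_mul]
  omega

/-- Value of the (clipped) body on the intended records. [folklore] -/
theorem bodyF_Z (f : List Bool → List Bool) (cnt : List Bool) {r : ℕ} {st : List Bool} (hkb : K n ≤ kb.length) (hr : r ≤ R n)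
    (hst : (keyAt n kb j r).length ≤ st.length) :
    bodyF f (Zrec n j kb x cnt r st) = boolPair (ones (r + 1)) (candStr f n j (keyAt n kb j r) st ++ (x.drop (N n + r)).take 1) := by
  rw [bodyF, clipF_eq_self, body_raw_Z f cnt r hst]
  rw [body_raw_Z f cnt r hst, length_boolPair]
  refine le_trans ?_ (le_of_le_of_eq (body_fits (j := j) (x := x) hkb hr) (by simp [Zrec]))
  simp only [ones, List.length_replicate, List.length_append, List.length_take]
  have := length_F3Str_le (f := f) (n := n) j (List.zipWith xor (keyAt n kb j r) st)
  rw [candStr]; omega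

/-- **The loop computes the chain**: from `⟨1ʳ, st_r⟩` with `k` active rounds, `r + k ≤ R`, the model ends
at `⟨1^{r+k}, st_{r+k}⟩`. [cite: HaitnerEtAl2020, Lemma 5.7] -/
theorem loopModel_bodyF (f : List Bool → List Bool) (hkb : K n ≤ kb.length) (hj : j < Jp1 n) (hx : x.length = d n) :
    ∀ (k r : ℕ), r + k ≤ R n →
      loopModel (bodyF f) (Xrec n j kb x) k (boolPair (ones r) (chainSt f n j kb x r)) =
        boolPair (ones (r + k)) (chainSt f n j kb x (r + k))
  | 0, _, _ => rfl
  | k + 1, r, hk => by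
    rw [loopModel, show boolPair (Xrec n j kb x) (boolPair (encodeNat (k + 1)) (boolPair (ones r) (chainSt f n j kb x r))) =
      Zrec n j kb x (encodeNat (k + 1)) r (chainSt f n j kb x r) from rfl,
      bodyF_Z f _ hkb (by omega) (by rw [length_chainSt hkb hj hx (by omega)]; exact length_keyAt_le _ _ _),
      show candStr f n j (keyAt n kb j r) (chainSt f n j kb x r) ++ (x.drop (N n + r)).take 1 = chainSt f n j kb x (r + 1) from rfl,
      loopModel_bodyF f hkb hj hx k (r + 1) (by omega)]
    congr 2 <;> omega

/-- Growth of the clipped body (what `loopFn_mem_FP` asks). [folklore] -/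
theorem length_bodyF_le (f : List Bool → List Bool) (z : List Bool) :
    (bodyF f z).length ≤ (sndPow 1 z).length + 1 * ((fstF z).length + 1) := by
  rw [bodyF]; exact (length_clipF_le _ _ _).trans (Nat.le_add_left _ _)

/-- `keyF ∈ FP`. [folklore] -/
theorem keyF_mem_FP : keyF ∈ FP := by
  have h1 : HashBricks.umulFn ∘ fanoutFn (XjF ∘ nthF 0) (XszF (add E.R (cst 1)) ∘ nthF 0) ∈ FP :=
    comp_mem_FP HashBricks.umulFn_mem_FP (fanoutFn_mem_FP (comp_mem_FP XjF_mem_FP (nthF_mem_FP 0))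
      (comp_mem_FP (XszF_mem_FP _) (nthF_mem_FP 0)))
  have h2 : HashBricks.umulFn ∘ fanoutFn (catF (HashBricks.umulFn ∘ fanoutFn (XjF ∘ nthF 0) (XszF (add E.R (cst 1)) ∘ nthF 0))
      (nthF 2)) (XszF E.N ∘ nthF 0) ∈ FP :=
    comp_mem_FP HashBricks.umulFn_mem_FP (fanoutFn_mem_FP (catF_mem_FP h1 (nthF_mem_FP 2))
      (comp_mem_FP (XszF_mem_FP _) (nthF_mem_FP 0)))
  exact comp_mem_FP takeFn_mem_FP (fanoutFn_mem_FP (comp_mem_FP (XszF_mem_FP _) (nthF_mem_FP 0))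
    (comp_mem_FP dropFn_mem_FP (fanoutFn_mem_FP h2 (comp_mem_FP XkF_mem_FP (nthF_mem_FP 0)))))

/-- `cbitF ∈ FP`. [folklore] -/
theorem cbitF_mem_FP : cbitF ∈ FP :=
  comp_mem_FP takeFn_mem_FP (fanoutFn_mem_FP (const_mem_FP _)
    (comp_mem_FP dropFn_mem_FP (fanoutFn_mem_FP (catF_mem_FP (comp_mem_FP (XszF_mem_FP _) (nthF_mem_FP 0)) (nthF_mem_FP 2))
      (comp_mem_FP XxF_mem_FP (nthF_mem_FP 0)))))

/-- `stepF f ∈ FP` for `f ∈ FP`. [folklore] -/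
theorem stepF_mem_FP {f : List Bool → List Bool} (hf : f ∈ FP) : stepF f ∈ FP :=
  comp_mem_FP (candP_mem_FP hf) (fanoutFn_mem_FP (comp_mem_FP XnF_mem_FP (nthF_mem_FP 0))
    (fanoutFn_mem_FP (comp_mem_FP XjF_mem_FP (nthF_mem_FP 0)) (fanoutFn_mem_FP keyF_mem_FP (sndPow_mem_FP 2))))

/-- `bodyF f ∈ FP` for `f ∈ FP`. [folklore] -/
theorem bodyF_mem_FP {f : List Bool → List Bool} (hf : f ∈ FP) : bodyF f ∈ FP :=
  clipF_mem_FP 1 (fanoutFn_mem_FP (comp_mem_FP (cons_mem_FP true) (nthF_mem_FP 2)) (catF_mem_FP (stepF_mem_FP hf) cbitF_mem_FP))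

/-- The loop initialisation `X ↦ ⟨X, ⟨bin R, ⟨1⁰, x ↾ N⟩⟩⟩`. [folklore] -/
noncomputable def chainInitF : List Bool → List Bool :=
  fanoutFn id (fanoutFn (lenBinF ∘ XszF E.R) (fanoutFn (fun _ => []) (takeFn ∘ fanoutFn (XszF E.N) XxF)))

/-- The loop: `polyOf E.R (|X|) ≥ R` clocked rounds. [folklore] -/
noncomputable def chainLoopF (f : List Bool → List Bool) (z : List Bool) : List Bool :=
  (loopStep (bodyF f))^[(polyOf E.R).eval (fstF z).length] z

/-- The output map `z ↦ G_{y_R}(st_R)` (the same accessors as the body, at `r = R`). [folklore] -/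
noncomputable def chainOutF (f : List Bool → List Bool) : List Bool → List Bool := stepF f

/-- **The chain brick** `chainP f X = chainOutStr f n j kb x` on well-formed `X = ⟨⟨1ⁿ, ⟨kb, x⟩⟩, 1ʲ⟩`.
[cite: HaitnerEtAl2020, Lemma 5.7] -/
noncomputable def chainP (f : List Bool → List Bool) : List Bool → List Bool := chainOutF f ∘ chainLoopF f ∘ chainInitF

/-- Value of the initialisation. [folklore] -/
theorem chainInitF_X : chainInitF (Xrec n j kb x) = Zrec n j kb x (encodeNat (R n)) 0 (x.take (N n)) := by
  rw [chainInitF, fanoutFn_apply, fanoutFn_apply, fanoutFn_apply, id, Function.comp_apply, XszF_X, lenBinF_apply,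
    Function.comp_apply, fanoutFn_apply, XszF_X, XxF_X, takeFn_boolPair]
  simp [Zrec, ones]

/-- **`chainP f X = chainOutStr f n j kb x`** for `|kb| ≥ K`, `j ≤ J`, `|x| = d`. [cite: HaitnerEtAl2020, Lemma 5.7] -/
theorem chainP_apply (f : List Bool → List Bool) (hkb : K n ≤ kb.length) (hj : j < Jp1 n) (hx : x.length = d n) :
    chainP f (Xrec n j kb x) = chainOutStr f n j kb x := by
  have hR : R n ≤ (polyOf E.R).eval (Xrec n j kb x).length := by
    refine eval_le_polyOf E.R ?_
    simp [Xrec, ones]; omega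
  rw [chainP, Function.comp_apply, Function.comp_apply, chainInitF_X, chainLoopF, Zrec, fstF_boolPair,
    iterate_loopStep _ _ _ _ _ hR,
    show x.take (N n) = chainSt f n j kb x 0 from rfl, loopModel_bodyF f hkb hj hx (R n) 0 (by omega), Nat.zero_add,
    chainOutF, show boolPair (Xrec n j kb x) (boolPair [] (boolPair (ones (R n)) (chainSt f n j kb x (R n)))) =
      Zrec n j kb x [] (R n) (chainSt f n j kb x (R n)) from rfl,
    stepF_Z f _ _ (by rw [length_chainSt hkb hj hx le_rfl]; exact length_keyAt_le _ _ _), chainOutStr]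

/-- `chainInitF ∈ FP`. [folklore] -/
theorem chainInitF_mem_FP : chainInitF ∈ FP :=
  fanoutFn_mem_FP (PolyTimeComputable.id _) (fanoutFn_mem_FP
    (comp_mem_FP lenBinF_mem_FP (XszF_mem_FP _)) (fanoutFn_mem_FP (const_mem_FP _)
      (comp_mem_FP takeFn_mem_FP (fanoutFn_mem_FP (XszF_mem_FP _) XxF_mem_FP))))

/-- `chainLoopF f ∈ FP` for `f ∈ FP` (a counted loop with a body of constant growth). [cite: AroraBarakCC2009, §1.3] -/
theorem chainLoopF_mem_FP {f : List Bool → List Bool} (hf : f ∈ FP) : chainLoopF f ∈ FP :=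
  loopFn_mem_FP (bodyF_mem_FP hf) (length_bodyF_le f) (polyOf E.R)

/-- `chainP f ∈ FP` for `f ∈ FP`. [cite: HaitnerEtAl2020, Lemma 5.7 with proof of Thm. 5.1 ("polynomial time")] -/
theorem chainP_mem_FP {f : List Bool → List Bool} (hf : f ∈ FP) : chainP f ∈ FP :=
  comp_mem_FP (stepF_mem_FP hf) (comp_mem_FP (chainLoopF_mem_FP hf) chainInitF_mem_FP)

end ChainBrick

/-! ### The evaluator brick and the hash collection -/

section Family

/-- The context `⟨1ⁿ, ⟨kb, x⟩⟩` from the pair `⟨s, x⟩`, `s = 1ⁿ 0 kb`. [folklore] -/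
noncomputable def ctxF : List Bool → List Bool :=
  fanoutFn (onesPrefixFn ∘ fstF) (fanoutFn (afterZeroFn ∘ fstF) sndF)

/-- `ctxF ⟨1ⁿ 0 kb, x⟩ = ⟨1ⁿ, ⟨kb, x⟩⟩`. [folklore] -/
theorem ctxF_apply (n : ℕ) (kb x : List Bool) :
    ctxF (boolPair (ones n ++ false :: kb) x) = boolPair (ones n) (boolPair kb x) := by
  simp [ctxF]

/-- `ctxF ∈ FP`. [folklore] -/
theorem ctxF_mem_FP : ctxF ∈ FP :=
  fanoutFn_mem_FP (comp_mem_FP onesPrefixFn_mem_FP fstF_mem_FP)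
    (fanoutFn_mem_FP (comp_mem_FP afterZeroFn_mem_FP fstF_mem_FP) sndF_mem_FP)

/-- **The evaluator brick** (before length normalisation): the concatenation fold of the `J + 1` chains.
[cite: HaitnerEtAl2020, proof of Thm. 5.1, Step 5] -/
noncomputable def evalP (f : List Bool → List Bool) : List Bool → List Bool :=
  foldCat (polyOf E.Nm1) (polyOf E.Jp1) (chainP f) ∘ fanoutFn id (szF E.Jp1) ∘ ctxF

/-- **`evalP f ⟨1ⁿ 0 kb, x⟩ = evalStr f n kb x`** for `|kb| ≥ K n`, `|x| = d n`. [cite: HaitnerEtAl2020, proof of Thm. 5.1, Step 5] -/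
theorem evalP_apply (f : List Bool → List Bool) {n : ℕ} {kb x : List Bool} (hkb : K n ≤ kb.length) (hx : x.length = d n) :
    evalP f (boolPair (ones n ++ false :: kb) x) = evalStr f n kb x := by
  have hn : n ≤ (boolPair (ones n) (boolPair kb x)).length := by simp [ones]; omega
  rw [evalP, Function.comp_apply, Function.comp_apply, ctxF_apply, fanoutFn_apply, id, szF_boolPair]
  simp only [E.Jp1_eval, if_pos]
  rw [foldCat_apply]
  · simp only [ones, List.length_replicate]
    exact ccat_congr fun j hj => chainP_apply (n := n) (j := j) (kb := kb) (x := x) f hkb hj hx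
  · rw [List.length_replicate]; exact eval_le_polyOf E.Jp1 hn
  · intro j hj
    rw [List.length_replicate] at hj
    rw [show boolPair (boolPair (ones n) (boolPair kb x)) (ones j) = Xrec n j kb x from rfl, chainP_apply f hkb hj hx]
    exact (length_chainOutStr_le _ _ _).trans (eval_le_polyOf E.Nm1 hn)

/-- `evalP f ∈ FP` for `f ∈ FP`. [cite: HaitnerEtAl2020, proof of Thm. 5.1 ("polynomial-time computable")] -/
theorem evalP_mem_FP {f : List Bool → List Bool} (hf : f ∈ FP) : evalP f ∈ FP :=
  comp_mem_FP (foldCat_mem_FP _ _ (chainP_mem_FP hf)) (comp_mem_FP (fanoutFn_mem_FP (PolyTimeComputable.id _) (szF_mem_FP _)) ctxF_mem_FP)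

variable (p : Polynomial ℕ)

/-- The output length `(J+1)(N−1)` at the level `n = nOf p |s|`, in unary, from `⟨s, x⟩`. [folklore] -/
noncomputable def rlenF : List Bool → List Bool := szF (mul E.Jp1 E.Nm1) ∘ fanoutFn (LenPres.nOfFn p ∘ fstF) fun _ => []

/-- Value of `rlenF`. [folklore] -/
theorem rlenF_apply (s x : List Bool) :
    rlenF p (boolPair s x) = ones (Jp1 (LenPres.nOf p s.length) * Nm1 (LenPres.nOf p s.length)) := by
  rw [rlenF, Function.comp_apply, fanoutFn_apply, Function.comp_apply, fstF_boolPair, LenPres.nOfFn_apply, szF_boolPair]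
  simp

/-- `rlenF p ∈ FP`. [folklore] -/
theorem rlenF_mem_FP : rlenF p ∈ FP :=
  comp_mem_FP (szF_mem_FP _) (fanoutFn_mem_FP (comp_mem_FP (LenPres.nOfFn_mem_FP p) fstF_mem_FP) (const_mem_FP _))

/-- **The hash brick**: the evaluator, cut and padded to `(J+1)(N−1)` symbols at the level of `|s|`.
[cite: HaitnerEtAl2020, proof of Thm. 5.1, Step 5; Goldreich 2004, Def. 6.4.19 (range)] -/
noncomputable def hashP (f : List Bool → List Bool) : List Bool → List Bool :=
  catF (takeFn ∘ fanoutFn (rlenF p) (evalP f)) (Kannan.zerosFn ∘ dropFn ∘ fanoutFn (evalP f) (rlenF p))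

/-- `hashP p f ⟨s, x⟩ = fitLen ((J+1)(N−1)) (evalP f ⟨s, x⟩)` (level `nOf p |s|`). [folklore] -/
theorem hashP_apply (f : List Bool → List Bool) (s x : List Bool) :
    hashP p f (boolPair s x) =
      fitLen (Jp1 (LenPres.nOf p s.length) * Nm1 (LenPres.nOf p s.length)) (evalP f (boolPair s x)) := by
  rw [hashP, catF_apply, Function.comp_apply, fanoutFn_apply, Function.comp_apply, Function.comp_apply, fanoutFn_apply,
    rlenF_apply, takeFn_boolPair, dropFn_boolPair, Kannan.zerosFn_apply, fitLen]
  simp [ones]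

/-- `hashP p f ∈ FP` for `f ∈ FP`. [cite: HaitnerEtAl2020, proof of Thm. 5.1 ("polynomial-time computable")] -/
theorem hashP_mem_FP {f : List Bool → List Bool} (hf : f ∈ FP) : hashP p f ∈ FP :=
  catF_mem_FP (comp_mem_FP takeFn_mem_FP (fanoutFn_mem_FP (rlenF_mem_FP p) (evalP_mem_FP hf)))
    (comp_mem_FP Kannan.zerosFn_mem_FP (comp_mem_FP dropFn_mem_FP (fanoutFn_mem_FP (evalP_mem_FP hf) (rlenF_mem_FP p))))

/-- **The hash collection of HHRVW's Theorem 5.1** for `f` with coin polynomial `p`: `I(1ⁿ; r) = 1ⁿ 0 r` on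
`p(n)` coins; `h_s(x)` the concatenated chained candidates at the level of `s`, length-normalised.
[cite: HaitnerEtAl2020, Thm. 5.1 (the family `G`)] -/
noncomputable def family (f : List Bool → List Bool) : HashCollection where
  index := { run := fun n r => unaryEncodeNat n ++ false :: r, coinLen := fun L => p.eval L }
  hash := fun s x => hashP p f (boolPair s x)

variable {p}

/-- The domain length of the family at index length `L`: `d` at the level `nOf p L`. [cite: Goldreich2004, Def. 6.4.19] -/
def dLen (p : Polynomial ℕ) (L : ℕ) : ℕ := d (LenPres.nOf p L)

/-- The range length of the family at index length `L`: `(J+1)(N−1) = d − 1` at the level `nOf p L`.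
[cite: Goldreich2004, Def. 6.4.19] -/
def rLen (p : Polynomial ℕ) (L : ℕ) : ℕ := Jp1 (LenPres.nOf p L) * Nm1 (LenPres.nOf p L)

/-- `rLen + 1 = dLen`: the family shrinks its (restricted) domain by one bit. [cite: HaitnerEtAl2020, Lemma 5.7 and Step 5] -/
theorem rLen_add_one (p : Polynomial ℕ) (L : ℕ) : rLen p L + 1 = dLen p L := Jp1_mul_Nm1 _

/-- **Range**: `|h_s(x)| = rLen |s|` for every `s`, `x`. [cite: Goldreich2004, Def. 6.4.19] -/
theorem length_family_hash (f : List Bool → List Bool) (s x : List Bool) : ((family p f).hash s x).length = rLen p s.length := by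
  show (hashP p f (boolPair s x)).length = _
  rw [hashP_apply, length_fitLen, rLen]

/-- The index at parameter `n` with coins `r`: `1ⁿ 0 r`, of length `|r| + n + 1`. [folklore] -/
theorem family_index_run (f : List Bool → List Bool) (n : ℕ) (r : List Bool) :
    (family p f).index.run n r = ones n ++ false :: r := by
  show unaryEncodeNat n ++ false :: r = _
  rw [unaryEncodeNat_eq_replicate]

/-- Indices in the range of `I(1ⁿ)` are `1ⁿ 0 r` with `|r| = p(n)`. [folklore] -/
theorem mem_support_family_index {f : List Bool → List Bool} {n : ℕ} {s : List Bool} (hs : s ∈ ((family p f).indexPMF n).support) :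
    ∃ r : List Bool, r.length = p.eval n ∧ s = ones n ++ false :: r := by
  rw [HashCollection.indexPMF, RandAlg.outputPMF, PMF.support_map] at hs
  obtain ⟨ρ, _, rfl⟩ := hs
  refine ⟨ρ.toList, ?_, family_index_run f n _⟩
  rw [List.Vector.toList_length]
  show p.eval (unaryEncodeNat n).length = _
  rw [unaryEncodeNat_eq_replicate, List.length_replicate]

/-- **Index length**: every index in the range of `I(1ⁿ)` has length `p(n) + n + 1 = LenPres.M p n`.
[cite: Goldreich2004, Def. 6.4.19 (1)] -/
theorem length_index_family {f : List Bool → List Bool} {n : ℕ} {s : List Bool} (hs : s ∈ ((family p f).indexPMF n).support) :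
    s.length = LenPres.M p n := by
  obtain ⟨r, hr, rfl⟩ := mem_support_family_index hs
  simp [ones, hr, LenPres.M]; ring

/-- The level of an index: `nOf p |s| = n` on the range of `I(1ⁿ)`. [folklore] -/
theorem nOf_length_index {f : List Bool → List Bool} {n : ℕ} {s : List Bool} (hs : s ∈ ((family p f).indexPMF n).support) :
    LenPres.nOf p s.length = n := by
  rw [length_index_family hs]
  exact LenPres.nOf_eq le_rfl (LenPres.M_strictMono (Nat.lt_succ_self n))

/-- **The value on well-formed indices**: for `s = 1ⁿ 0 kb` with `p(n) + n + 1 = |s|`... precisely for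
`|kb| = p(n) ≥ K(n)` and `|x| = d(n)`, `h_s(x) = evalStr f n kb x`. [cite: HaitnerEtAl2020, proof of Thm. 5.1, Step 5] -/
theorem family_hash_eq (f : List Bool → List Bool) {n : ℕ} {kb x : List Bool} (hkb : kb.length = p.eval n) (hK : K n ≤ p.eval n)
    (hx : x.length = d n) : (family p f).hash (ones n ++ false :: kb) x = evalStr f n kb x := by
  show hashP p f (boolPair (ones n ++ false :: kb) x) = _
  have hL : (ones n ++ false :: kb).length = LenPres.M p n := by simp [ones, hkb, LenPres.M]; ring
  rw [hashP_apply, hL, LenPres.nOf_eq le_rfl (LenPres.M_strictMono (Nat.lt_succ_self n)), evalP_apply f (hkb ▸ hK) hx,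
    fitLen_of_length_eq (length_evalStr (hkb ▸ hK) hx)]

/-- **Efficiency** (Def. 6.4.18/6.4.19 (2)): the index sampler is PPT and the evaluation is polynomial-time,
for `f ∈ FP`. [cite: HaitnerEtAl2020, Thm. 5.1 ("polynomial-time computable"); Goldreich 2004, Def. 6.4.19 (2)] -/
theorem isEfficient_family {f : List Bool → List Bool} (hf : f ∈ FP) : (family p f).IsEfficient := by
  constructor
  · refine ⟨?_, p, fun L => le_rfl⟩
    have hg : catF fstF (List.cons false ∘ sndF) ∈ FP := catF_mem_FP fstF_mem_FP (comp_mem_FP (cons_mem_FP false) sndF_mem_FP)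
    obtain ⟨pc, Mc, hM⟩ := hg
    refine ⟨pc, Mc, fun q => ?_⟩
    have h := hM (boolPair (unaryEncodeNat q.1) q.2)
    rw [id, catF_apply, fstF_boolPair, Function.comp_apply, sndF_boolPair] at h
    exact h
  · obtain ⟨pc, Mc, hM⟩ := hashP_mem_FP p hf
    exact ⟨pc, Mc, fun q => hM (boolPair q.1 q.2)⟩

/-- The coin budget of the index sampler is the polynomial `p`. [folklore] -/
@[simp] theorem family_index_coinLen (f : List Bool → List Bool) (L : ℕ) : (family p f).index.coinLen L = p.eval L := rfl

end Family

end HHRVW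

end Literature.Computability.Cryptography
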